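/-
Copyright (c) 2026 the pub-hodgecm-mathlib formalisation cell (harness21).  Prover seat hodgecm-mathlib-LH4-p14 (g6), req620 Track A «(D-RAM) FOUR-FRAME» squad, helper lane
on h413 = stmt-HodgeConjecture-24833 (count-neutral).  STAGE-1b VEHICLE brick (V5-lev) — row (3) column in (R)-shape for the LEVEL pieces (heir LEAD T19-30 (3) ∕ T19-31 (b)), companion of ★ p859233.  2026-09-04.
-/
import Summits.HodgeConjecture.HodgeConjecture.Theorems.F0P3cDyRamLevelsLeviRow         -- ★ (LH4-p08 (g7)): the EXACT Levi row G-side of the congruence-profile pieces `𝟙_{K_{a,b}}`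
import Summits.HodgeConjecture.HodgeConjecture.Theorems.F0P3cDyRamHProfilesLeviRatio    -- ★ (ρ3b′) `hProfiles_levi_ratio_wild`
import Summits.HodgeConjecture.HodgeConjecture.Theorems.F0P3cDyRamRowThreeReduction     -- ★ `measureReal_support_hFamily_ne_zero`
import HarnessLib

/-!
# Crux `H413`, line LH4 «(D-RAM) FOUR-FRAME» — (V5-lev) THE LEVI ROW OF A CONGRUENCE-PROFILE PIECE `𝟙_{K_{a,b}}` FOR `ψ := hFamily` FROM ONE SCALAR IDENTITY

Cell `hodgecm-mathlib` (D-0151), FLOOR 0, crux item H413 = `stmt-HodgeConjecture-24833`, route `HCCMUnconditional`; squad F0∕P3c∕LH4.  THEOREMS ONLY (no `def`, no instance, no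
notation, no `sorry`, default heartbeats); ★ `Theorems` imports only; lane `--supports stmt-HodgeConjecture-24833 --as helper`; COUNT-NEUTRAL (`hnum` is a HYPOTHESIS; nothing asserted).

WHY.  After ★ p858649 (linearity) the tier-0 rows `transvMinus` ∕ `regular` (and the unlabelled half of `transvPlus`) are carried by the congruence-profile pieces `𝟙_{K_{a,b}}` (★ p859209
(V-lev)∕(V-sq) junctions, ★ `…TierZeroRowsTwoThreeOfLevels` compositions, p06 (g6)); their rows share ONE vector `coef` over `hFamily` ((R), heir LEAD T19-30 (3)).  LH4-p08 (g7)'s ★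
`exists_nhds_one_finsum_delta_levels_eq_of_levi` made the LEVI G-side EXACT: `Σᶠ_c Δ‴·Φ(c, 𝟙_{K_{a,b}}) = q_v^{−e(a,b,d)}·(νG₃(K)∕νH(K_H))·Φ^st(γ_H, hFamily 0)`.  Hence, by ★ (ρ3b′)
`hProfiles_levi_ratio_wild`, ROW (3) of `𝟙_{K_{a,b}}` for `(hFamily, coef)` is EQUIVALENT to ONE identity between numbers, `coef 0·ν_0 + coef 1·ν_1 = q_v^{−e}·(νG₃(K)∕νH(K_H))·ν_0` —
this file's `rowThree_levels_hFamily_of_scalar` (the level-piece twin of ★ p859233 (V5) for the frozen pieces).  At `coef := coefAffine(cA, cB)` (★ p859018) the left number is `cA∕2`.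
HONEST LABEL.  Count-neutral; pays no registered stub, touches no `Lines/` module; `HC_CM` is proved only modulo the 7 printed citations (2 remaining named inputs: hLiu418 =
`stmt-HodgeConjecture-24832`, h413 = `stmt-HodgeConjecture-24833`) until rung 0 closes.

## References
* [Rogawski1990] J. D. Rogawski, *Automorphic Representations of Unitary Groups in Three Variables*, Ann. of Math. Stud. 123 (1990): §4.9 Prop. 4.9.1 (b) p. 55, Lemmas 4.9.2–4.9.3 p. 56; §4.3 (4.3.1) p. 43.
* [Kottwitz1986BaseChangeUnits] R. E. Kottwitz, *Base change for unit elements of Hecke algebras*, Compositio Math. 60 (1986), §1 pp. 240–241.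
-/

set_option autoImplicit false

noncomputable section

namespace Summit.HodgeConjecture.HodgeConjecture.Cruxes.H413.F0P3cDyRamLevelsLeviRowScalar

open MeasureTheory Measure NumberField IsDedekindDomain Topology Filter
open Literature.NumberTheory.Automorphic Literature.NumberTheory.Automorphic.UnitaryGroup Literature.NumberTheory.Automorphic.IntegralReduction
open Literature.NumberTheory.Automorphic.UnitaryLatticeTree Literature.NumberTheory.Automorphic.HermitianLattice
open Literature.NumberTheory.Rogawski1990 Literature.NumberTheory.GaloisRepresentations
open scoped Matrix MatrixGroups Classical ValuativeRel WithZero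
open Summit.HodgeConjecture.HodgeConjecture.Cruxes.H413.F0P3cDyRamFourFramePieces
open Summit.HodgeConjecture.HodgeConjecture.Cruxes.H413.F0P3cDyRamFourFrameHFamilyDefs
open Summit.HodgeConjecture.HodgeConjecture.Cruxes.H413.F0P3cDyRamLevelsLeviRow
open Literature.NumberTheory.Automorphic.UnitaryThreeFourFrame
open Summit.HodgeConjecture.HodgeConjecture.Cruxes.H413.F0P3cDyRamProfileLevelClass
open Summit.HodgeConjecture.HodgeConjecture.Cruxes.H413.F0P3cDyRamHProfilesLeviRatio
open Summit.HodgeConjecture.HodgeConjecture.Cruxes.H413.F0P3cDyRamRowThreeReduction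

/-- **(V5-lev) `rowThree_levels_hFamily_of_scalar` — THE LEVI ROW OF A CONGRUENCE-PROFILE PIECE `𝟙_{K_{a,b}}` FOR `ψ := hFamily` FROM ONE SCALAR IDENTITY.**
Binders = ★ `exists_nhds_one_finsum_delta_levels_eq_of_levi`'s VERBATIM (`a, b ≤ m*`; the Haar `μ_N` is a witness that cancels there).  For ANY `coef : Fin 2 → ℂ`: IF the NUMBERS
satisfy `coef 0·ν_0 + coef 1·ν_1 = q_v^{−e(a,b,d)} · (νG₃(K)∕νH(K_H)) · ν_0` (`ν_s = νH(supp hFamily s)`, `e` = ★ p859102's exponent), THEN near `1` on the Levi population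
`Σᶠ_c Δ‴_v[μ](γ_H, out c)·Φ(c, 𝟙_{K_{a,b}}) = Σ_s coef_s·Φ^st(γ_H, hFamily s)` — the ROW-(3) conjunct of the rows socket for the piece (★ p859209 (V-lev)'s `hH` row (3), p06 (g6)).
★ exact law (LH4-p08 (g7)) + ★ (ρ3b′) `hProfiles_levi_ratio_wild` + `ν_0 ≠ 0`; `linear_combination`.  At ★ p859018's vector `coefAffine(cA, cB)` the left number is `cA∕2` (two-germ
rigidity: the Levi row reads the `V(N)`-slope of row (1) only — F0P3-p01 (g35) «𝒜 = ρ»).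
[cite: Rogawski1990, §4.9 Prop. 4.9.1 (b) p. 55, Lemma 4.9.3 p. 56] [cite: Kottwitz1986BaseChangeUnits, §1 pp. 240–241] -/
theorem rowThree_levels_hFamily_of_scalar
    (L : Type) [Field L] [NumberField L] [IsCMField L]
    {v : HeightOneSpectrum (𝓞 ↥(maximalRealSubfield L))} (w : UnitaryGroup.PlacesOver L v)
    (hw : IsCMField.complexConj L • w.1 = w.1)
    (he : v.asIdeal.ramificationIdx' w.1.asIdeal ≠ 1)
    (h2 : ¬ IsUnit (2 : 𝒪[w.1.adicCompletion L]))
    (ϖ : w.1.adicCompletion L) (hϖ : Valued.v ϖ = WithZero.exp (-1 : ℤ))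
    (d tE : ℕ) (hD : IsRamifiedQuadraticDatum (galAdicCompletionMap (L := L) (IsCMField.complexConj L) hw) ϖ d tE)
    (a b : ℕ) (ha : a ≤ mstarFn L v w) (hb : b ≤ mstarFn L v w)
    (μ : HeckeCharacter L)
    (hμω : ∀ x : ideleGroup ↥(maximalRealSubfield L), μ (AdeleRing.ideleBaseChange ↥(maximalRealSubfield L) L x) = quadraticHeckeCharCM L x)
    [MeasurableSpace ((cmDatum L 3 (Matrix.of fun i j : Fin 3 => if i.val + j.val + 1 = 3 then (1 : L) else 0)).Local v)]
    [BorelSpace ((cmDatum L 3 (Matrix.of fun i j : Fin 3 => if i.val + j.val + 1 = 3 then (1 : L) else 0)).Local v)]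
    [∀ γ : ((cmDatum L 3 (Matrix.of fun i j : Fin 3 => if i.val + j.val + 1 = 3 then (1 : L) else 0)).Local v),
      MeasurableSpace (((cmDatum L 3 (Matrix.of fun i j : Fin 3 => if i.val + j.val + 1 = 3 then (1 : L) else 0)).Local v) ⧸
        Subgroup.centralizer ({γ} : Set ((cmDatum L 3 (Matrix.of fun i j : Fin 3 => if i.val + j.val + 1 = 3 then (1 : L) else 0)).Local v)))]
    [∀ γ : ((cmDatum L 3 (Matrix.of fun i j : Fin 3 => if i.val + j.val + 1 = 3 then (1 : L) else 0)).Local v),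
      BorelSpace (((cmDatum L 3 (Matrix.of fun i j : Fin 3 => if i.val + j.val + 1 = 3 then (1 : L) else 0)).Local v) ⧸
        Subgroup.centralizer ({γ} : Set ((cmDatum L 3 (Matrix.of fun i j : Fin 3 => if i.val + j.val + 1 = 3 then (1 : L) else 0)).Local v)))]
    [MeasurableSpace ((cmDatum L 2 (Matrix.of fun i j : Fin 2 => if i.val + j.val + 1 = 2 then (1 : L) else 0)).Local v ×
      (cmDatum L 1 (Matrix.of fun i j : Fin 1 => if i.val + j.val + 1 = 1 then (1 : L) else 0)).Local v)]
    [BorelSpace ((cmDatum L 2 (Matrix.of fun i j : Fin 2 => if i.val + j.val + 1 = 2 then (1 : L) else 0)).Local v ×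
      (cmDatum L 1 (Matrix.of fun i j : Fin 1 => if i.val + j.val + 1 = 1 then (1 : L) else 0)).Local v)]
    [∀ a : ((cmDatum L 2 (Matrix.of fun i j : Fin 2 => if i.val + j.val + 1 = 2 then (1 : L) else 0)).Local v ×
      (cmDatum L 1 (Matrix.of fun i j : Fin 1 => if i.val + j.val + 1 = 1 then (1 : L) else 0)).Local v),
      MeasurableSpace (((cmDatum L 2 (Matrix.of fun i j : Fin 2 => if i.val + j.val + 1 = 2 then (1 : L) else 0)).Local v ×
      (cmDatum L 1 (Matrix.of fun i j : Fin 1 => if i.val + j.val + 1 = 1 then (1 : L) else 0)).Local v) ⧸ Subgroup.centralizer ({a} : Set ((cmDatum L 2 (Matrix.of fun i j : Fin 2 => if i.val + j.val + 1 = 2 then (1 : L) else 0)).Local v ×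
      (cmDatum L 1 (Matrix.of fun i j : Fin 1 => if i.val + j.val + 1 = 1 then (1 : L) else 0)).Local v)))]
    [∀ a : ((cmDatum L 2 (Matrix.of fun i j : Fin 2 => if i.val + j.val + 1 = 2 then (1 : L) else 0)).Local v ×
      (cmDatum L 1 (Matrix.of fun i j : Fin 1 => if i.val + j.val + 1 = 1 then (1 : L) else 0)).Local v),
      BorelSpace (((cmDatum L 2 (Matrix.of fun i j : Fin 2 => if i.val + j.val + 1 = 2 then (1 : L) else 0)).Local v ×
      (cmDatum L 1 (Matrix.of fun i j : Fin 1 => if i.val + j.val + 1 = 1 then (1 : L) else 0)).Local v) ⧸ Subgroup.centralizer ({a} : Set ((cmDatum L 2 (Matrix.of fun i j : Fin 2 => if i.val + j.val + 1 = 2 then (1 : L) else 0)).Local v ×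
      (cmDatum L 1 (Matrix.of fun i j : Fin 1 => if i.val + j.val + 1 = 1 then (1 : L) else 0)).Local v)))]
    (νH : Measure ((cmDatum L 2 (Matrix.of fun i j : Fin 2 => if i.val + j.val + 1 = 2 then (1 : L) else 0)).Local v ×
      (cmDatum L 1 (Matrix.of fun i j : Fin 1 => if i.val + j.val + 1 = 1 then (1 : L) else 0)).Local v)) [νH.IsHaarMeasure] [νH.IsMulRightInvariant]
    (νG₃ : Measure ((cmDatum L 3 (Matrix.of fun i j : Fin 3 => if i.val + j.val + 1 = 3 then (1 : L) else 0)).Local v)) [νG₃.IsHaarMeasure] [νG₃.IsMulRightInvariant]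
    {mH : OrbitalMeasureFamily ((cmDatum L 2 (Matrix.of fun i j : Fin 2 => if i.val + j.val + 1 = 2 then (1 : L) else 0)).Local v ×
      (cmDatum L 1 (Matrix.of fun i j : Fin 1 => if i.val + j.val + 1 = 1 then (1 : L) else 0)).Local v)}
    {mG₃ : OrbitalMeasureFamily ((cmDatum L 3 (Matrix.of fun i j : Fin 3 => if i.val + j.val + 1 = 3 then (1 : L) else 0)).Local v)}
    (hmH : mH.IsCanonical (IsLocalGRegular L v) νH)
    (hmG : mG₃.IsCanonical (fun γ => IsRegularElt (γ.val : GL (Fin 3) (UnitaryGroup.LocalRing L v))) νG₃)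
    [MeasurableSpace ↥(unitaryGroupOfForm (conjLocal L (IsCMField.complexConj L) v) (cmLocalForm L 3 v))] [BorelSpace ↥(unitaryGroupOfForm (conjLocal L (IsCMField.complexConj L) v) (cmLocalForm L 3 v))]
    (μN : Measure ↥(unipotentU (conjLocal L (IsCMField.complexConj L) v) (cmLocalForm L 3 v))) [μN.IsHaarMeasure] [SFinite μN]
    (coef : Fin 2 → ℂ)
    (hnum : coef 0 * (νH.real (Function.support (hFamily L w hw ϖ 0)) : ℂ) + coef 1 * (νH.real (Function.support (hFamily L w hw ϖ 1)) : ℂ) =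
          ((((Ideal.absNorm v.asIdeal : ℝ) ^ ((max (max a ((b + 1) / 2)) ((a + d) / 2) - d / 2) + (a - d % 2 + 1) / 2))⁻¹) : ℂ) *
          (((νG₃.real (cmLocalIntegralLevel L 3 (Matrix.of fun i j : Fin 3 => if i.val + j.val + 1 = 3 then (1 : L) else 0) v : Set ((cmDatum L 3 (Matrix.of fun i j : Fin 3 => if i.val + j.val + 1 = 3 then (1 : L) else 0)).Local v)) : ℂ) /
            (νH.real ((((cmLocalIntegralLevel L 2 (Matrix.of fun i j : Fin 2 => if i.val + j.val + 1 = 2 then (1 : L) else 0) v).prod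
              (cmLocalIntegralLevel L 1 (Matrix.of fun i j : Fin 1 => if i.val + j.val + 1 = 1 then (1 : L) else 0) v) : Subgroup _) : Set _)) : ℂ)) *
          (νH.real (Function.support (hFamily L w hw ϖ 0)) : ℂ))) :
    ∃ V ∈ 𝓝 (1 : ((cmDatum L 2 (Matrix.of fun i j : Fin 2 => if i.val + j.val + 1 = 2 then (1 : L) else 0)).Local v ×
        (cmDatum L 1 (Matrix.of fun i j : Fin 1 => if i.val + j.val + 1 = 1 then (1 : L) else 0)).Local v)),
      ∀ γH ∈ V, IsLocalGRegular L v γH →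
        (∃ (y : ((cmDatum L 2 (Matrix.of fun i j : Fin 2 => if i.val + j.val + 1 = 2 then (1 : L) else 0)).Local v ×
            (cmDatum L 1 (Matrix.of fun i j : Fin 1 => if i.val + j.val + 1 = 1 then (1 : L) else 0)).Local v)) (d' : Fin 2 → (UnitaryGroup.LocalRing L v)ˣ),
            glDiagonal 2 (UnitaryGroup.LocalRing L v) d' = ((y * γH * y⁻¹).1.val : GL (Fin 2) (UnitaryGroup.LocalRing L v))) →
        ∑ᶠ c : ConjClasses ((cmDatum L 3 (Matrix.of fun i j : Fin 3 => if i.val + j.val + 1 = 3 then (1 : L) else 0)).Local v),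
            ((finExplicitCollection L (Matrix.of fun i j : Fin 3 => if i.val + j.val + 1 = 3 then (1 : L) else 0) μ
              (finExplicitDelta_conj_left_all L (Matrix.of fun i j : Fin 3 => if i.val + j.val + 1 = 3 then (1 : L) else 0) μ)
              (finExplicitDelta_conj_right_all L (Matrix.of fun i j : Fin 3 => if i.val + j.val + 1 = 3 then (1 : L) else 0) μ)) v).Δ γH (Quotient.out c) *
            classOrbitalIntegral mG₃ (Set.indicator {u : ((cmDatum L 3 (Matrix.of fun i j : Fin 3 => if i.val + j.val + 1 = 3 then (1 : L) else 0)).Local v) |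
          u ∈ cmLocalIntegralLevel L 3 (Matrix.of fun i j : Fin 3 => if i.val + j.val + 1 = 3 then (1 : L) else 0) v ∧
          (InLevel ϖ a (wMatrix L w hw u - 1) ∧ InLevel ϖ b ((wMatrix L w hw u - 1) * (wMatrix L w hw u - 1)))} (fun _ => (1 : ℂ))) c =
          ∑ s, coef s * stableOrbitalIntegralRel (IsLocalStablyConjH L v) mH (hFamily L w hw ϖ s) γH := by
  obtain ⟨V₁, hV₁, h₁⟩ := exists_nhds_one_finsum_delta_levels_eq_of_levi L w hw he h2 ϖ hϖ d tE hD a b ha hb μ hμω νH νG₃ hmH hmG μN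
  obtain ⟨V₂, hV₂, hrat⟩ := hProfiles_levi_ratio_wild L w hw he h2 ϖ hϖ νH mH hmH
  have hν0 : (νH.real (Function.support (hFamily L w hw ϖ 0)) : ℂ) ≠ 0 := measureReal_support_hFamily_ne_zero L w hw he ϖ hϖ νH 0
  refine ⟨V₁ ∩ V₂, Filter.inter_mem hV₁ hV₂, fun γH hγ hreg hlevi => ?_⟩
  have e₁ := h₁ γH hγ.1 hreg hlevi
  have hr := hrat γH hγ.2 hreg hlevi
  rw [e₁, Fin.sum_univ_two]
  refine mul_left_cancel₀ hν0 ?_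
  linear_combination (-(coef 1)) * hr - stableOrbitalIntegralRel (IsLocalStablyConjH L v) mH (hFamily L w hw ϖ 0) γH * hnum

end Summit.HodgeConjecture.HodgeConjecture.Cruxes.H413.F0P3cDyRamLevelsLeviRowScalar

end
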